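import Summits.HodgeConjecture.HodgeConjecture.Theorems.HCCMUnconditionalOfFloor
import Summits.HodgeConjecture.HodgeConjecture.Theorems.HCCMUnconditionalS5cPrimeOfTwistedReduction
import Summits.HodgeConjecture.HodgeConjecture.Theorems.HCCMUnconditionalHLiu418OfTwoFacts
import Summits.HodgeConjecture.HodgeConjecture.Theorems.HCCMUnconditionalH21OfLevelStructure
import Literature.NumberTheory.DiophantineGeometry.AbelianSchemeModelOfSmoothProperModel
import Literature.NumberTheory.ComplexMultiplication.ShimuraTaniyamaPairDegOnePrimeHolds
import Literature.AlgebraicGeometry.Motives.AbelianSchemeModelTwistedReductionTate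
import Summits.HodgeConjecture.CorCM.Hyp21.S5cPrimeOfQ5
import Summits.HodgeConjecture.HodgeConjecture.Theorems.HCCMUnconditionalH21
import Literature.AlgebraicGeometry.Motives.AbelianSchemeModelTwistedReductionTateHolds
import HarnessLib

/-!
# HC_CM (`RankFourFaces.CMAbelianHodge`) from the FLOOR of printed facts — custodian editions, part 2 (v6 …)

Topic: summit `HodgeConjecture`, sub-problem `HodgeConjecture`, route `HCCMUnconditional`.  PROVER FILE (cell hodgecm-mathlib, ladder
HODGECM-MATHLIB rung 0; custodian seat B-p10, naming rights / review A-p18): sorry-free, axioms ⊆ trio, THEOREMS ONLY, namespace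
`Summit.HodgeConjecture.HodgeConjecture.Theorems`.  Continuation of `HCCMUnconditionalOfFloor.lean` (editions v1 … v5, which reached the 400-line cap
of a Theorems proof file); same conventions: one append-only EDITION per floor change, every binder a named printed statement or its verbatim text,
zero route items among the hypotheses, bodies pure by-name compositions of landed heads.

* **v6 `hc_cm_of_floor_v6` — «−III-0» + «F-S5c′ ↦ Q5»** (count 11 → **10**): row III-0 [Liu2021, Lem. 2.4 (1)] left the floor through A-p18's
  `HypLiu418.HLiu418_of_two_facts` (★ p620867) over A-p17's F6 theorem `albanese_bettiOne_pullback_bijective_of_isProjectiveOver` (★ p620156); the merged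
  Tate-compatibility fact F-S5c′ is replaced by the one twisted-reduction identity Q5 ([Shimura1998] §18.6 p. 129) through B-p20's closing theorem
  (★ p620235) over the E4 transport (★ p619784).

* **v7 `hc_cm_of_floor_v7` — «−S2₁′» + «−h₃» (E-19.11♭1) + «Q5 by name»** (count 10 → **8**): the degree-one Shimura–Taniyama pair F-S2₁′ left the
  floor through A-p02's theorem `shimuraTaniyamaPair_degOne'_holds` (★ p625063, the E2 «height-one road»); the converse-Néron–Ogg–Šafarevič binder `h₃`
  left through edition E-19.11♭1 (the h21 binder re-read as [Shimura1998] Thm. 21.4 + Prop. 19.10 without Thm. 19.11's «unramified ⟺ good reduction»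
  clause: (a) B-typ02 ★ p625011, (b) A-p01, (c) B-p21 ★ p624519 / B-p14 ★ p624877 + `Hyp21.H21_of_levelStructure_of_r₀Flat`); `hQ5` is typed by B-typ04's
  named fact (★ p621613) through the bridge `Hyp21.factRHS5c_of_Q5` (★ p622510).

* **v8 `hc_cm_of_floor_v8` — «−Q5»** (count 8 → **7**): the twisted-reduction identity Q5 left the floor through the Q5 pool's closer
  `forall_isTateCompatible_homReduction_conjFrob_tateSpecialisation_holds` (B-p20 ★ p629306; B-p09's line: (TW) + (T1)–(T3) + closer), fed by name through `Hyp21.factRHS5c_of_Q5`.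

* **v9 `hc_cm_of_floor_v9` — «−r₀» (E-ST)** (count 7 → **6**): the abelian-scheme-model bridge r₀ left the floor — the good-reduction notion in the
  hypothesis positions of the h21 binder and of Liu's Def. 4.5 is re-keyed to abelian-scheme models (edition E-ST), [Shimura1998] Thm. 18.6 is the closed
  theorem `shimura1998_thm18_6_holds` (★ p631138), and `h21` is the closed constant `Theorems.H21_proof` (★ p633027).  This landing also RE-ISSUES the
  bodies of v7/v8 (statements byte-identical) off the retired module `HCCMUnconditionalH21OfInertiaFlat`, whose sanity bridge
  `casselmanFlat_of_casselman` became unprovable at the E-ST re-type (it would need r₀).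

* **v10 `hc_cm_of_floor_v10` — edition E-III2 (R1′), count-neutral (6)**: rows III-2 (a)/(c) re-keyed to the print-exact named statements
  `oscillatorTriple_dictionaryExistence` / `admissible_occursInH1` (B-typ01 ★ p636445 defs; A-p07 ★ p637765 bridges + ★ p638274 head) through A-p07's `Hyp413Closing.H413_of_three_facts_flat`; the INVENTORY flag «*»
  (binder stronger than print) is removed.

A STATUS theorem, not a discharge: HC_CM is proved only modulo the 7 printed citations until rung 0 closes.
-/

set_option autoImplicit false

-- mandated namespace `Summit.HodgeConjecture.HodgeConjecture.Theorems` trips `linter.dupNamespace` (single-problem summit); off as in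
-- `HCCMUnconditionalOfFacts.lean` / `HCCMUnconditionalOfFloor.lean`.
set_option linter.dupNamespace false

noncomputable section

namespace Summit.HodgeConjecture.HodgeConjecture.Theorems

open scoped TensorProduct Matrix
open NumberField NumberField.InfinitePlace IsDedekindDomain
open HodgeCM.Model HodgeCM.Model.LiuIndex HodgeCM.Model.TowerCarrier
open Summit.HodgeConjecture.CorCM.Model
open Literature.AlgebraicGeometry.Motives (CMType AbelianVariety)
open Literature.AlgebraicGeometry.HodgeTheory Literature.NumberTheory.Automorphic.PicardCM
open Literature.AlgebraicGeometry.ShimuraVarieties Literature.AlgebraicGeometry.ShimuraVarieties.UnitaryCanonicalModel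
open Literature.NumberTheory.ComplexMultiplication
open Literature.NumberTheory.Automorphic
open Literature.NumberTheory.Automorphic.Liu2021 Literature.NumberTheory.Automorphic.Liu2021.AppendixC
open Literature.NumberTheory.Automorphic.Liu2021.Def411WeilCarriers (lineOf locF Rep)
open Summit.HodgeConjecture.CorCM.Transposition.OmegaTransport (realUnit)
open HodgeCM.Model.ArchSideTerm (e₁)
open Literature.NumberTheory.GelbartRogawski1991 Literature.NumberTheory.GelbartRogawski1991.UnitaryDualPair
open Literature.RepresentationTheory Literature.RepresentationTheory.Liu2021
open Summit.HodgeConjecture.CorCM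
open Summit.HodgeConjecture.CorCM.Transposition
open Literature.NumberTheory.GelbartRogawski1991.OscillatorTripleDictionary (OccursInH1 IsIsoToOmega)
open Summit.HodgeConjecture.CorCM.Lines.A3Liu418 (Thm415AtFace EpsRigidAtFace)
open Summit.HodgeConjecture.HodgeConjecture.Theses (HCCMUnconditional.HDel)

set_option synthInstance.maxHeartbeats 400000 in
set_option maxHeartbeats 8000000 in
/-- **FLOOR EDITION v6 — «−III-0» (count 11 → 10) with the «F-S5c′ ↦ Q5» strength swap folded in** (director g3 BATCH 106 (1)/107 (1)/108 (1)).
* **−III-0**: the binder `hL : albanese_bettiOne_pullback_bijective` ([Liu2021] Lem. 2.4 (1)) is GONE — `hLiu418 := HypLiu418.HLiu418_of_two_facts hFal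
  h415 h21 h413` (A-p18 ★ p620867) consumes the tree theorem `Liu2021.AppendixC.albanese_bettiOne_pullback_bijective_of_isProjectiveOver` (F6, A-p17
  ★ p620156: the (G)-road — α-compatible finite-Galois Albanese fan G1–G4ℂ, Albanese dimension base change, (R-ℂ) for the pieces) and rows III-11
  (`epsRigidAtFace_holds` ★ p619319) and HD3 (`HD3_proof`) by their closed terms.
* **F-S5c′ ↦ Q5**: the merged «F-RH′ + F-S5c + Tate» fact is replaced by the ONE twisted-reduction identity `hQ5` — [Shimura1998] §18.6 p. 129
  «`(Y^σ)~ = Ỹ^f`» read on Tate modules, spelled out (no def) exactly as the hypothesis of B-p20's closing theorem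
  `Hyp21.exists_finite_forall_exists_goodReductionAt_homReduction_conjFrob_isTateCompatible_of_twistedReduction` (★ p620235 over the E4 transport
  ★ p619784: B-p07 assembly, A-p04 L1, B-p12 L2, B-p09 L3a, A-p16 L3b, B-p19, B-p06 σ̃), which feeds `levelStructure_of_facts_degOne''` (★ p620239)
  together with F-S2₁′; `h21` then by A-p01's r₀ head `Hyp21.H21_of_levelStructure_of_r₀` (★ p617878) as in v5.
Hypotheses = EXACTLY: I-1′ `hF1e`, F-S2₁′ `hS2₁'`, Q5 `hQ5`, r₀ `hr₀`, `h₃`, III-2 (a) `hdict`, III-J3a `hJ3a`, III-2 (c) `hc`, VI-1 `hFal`, III-9′ `h415`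
(**10**).
A STATUS theorem: HC_CM is proved only modulo the 7 printed citations until rung 0 closes.
[cite: Liu2021, Thm. 4.18; Lem. 2.4 (1); Prop. 4.13; App. D Lem. D.1] [cite: Shimura1998, §18.6 proof of Thm. 18.6 (pp. 128–130); §11.1 Prop. 12, 14 (i);
Thm. 21.4] [cite: Faltings1983, Satz 4] [cite: BLRNeronModels1990, §1.2 Prop. 8 and §4.4 Thm. 1] [cite: SerreTate1968, §1 Thm. 1 and Lemma 2] -/
theorem hc_cm_of_floor_v6
    -- `hDel` ⇐ row I-1′ (I-6 by name)
    (hF1e : UnitaryCanonicalModel.Aux.canonicalModel_exists_ext_printed)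
    -- `h21` ⇐ F-S2₁′ + Q5 + r₀ + converse Néron–Ogg–Šafarevič (II-2, S7a–c, S5b, E4 transport, Serre–Tate §1 bridge by name)
    (hS2₁' : shimuraTaniyamaPair_degOne')
    -- F-S5c′ ↦ Q5 «(Y^σ)~ = Ỹ^f on Tate modules» (B-p20's closing theorem ★ p620235), spelled out, no def
    (hQ5 : ∀ {F₀ K : Type} [Field F₀] [Field K] [NumberField K] [Algebra F₀ K] {v : HeightOneSpectrum (𝓞 K)}
      {Aᵢ Aₐ : AbelianVariety K}
      {𝒜ᵢ 𝒜ₐ : Literature.AlgebraicGeometry.Motives.SchemeOver (HeightOneSpectrum.valuationSubringAtPrime K v)}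
      [CategoryTheory.GrpObj 𝒜ᵢ] [CategoryTheory.GrpObj 𝒜ₐ]
      (hi : Literature.NumberTheory.DiophantineGeometry.IsAbelianSchemeModel Aᵢ v 𝒜ᵢ)
      (ha : Literature.NumberTheory.DiophantineGeometry.IsAbelianSchemeModel Aₐ v 𝒜ₐ) (γ : K ≃ₐ[F₀] K)
      (hγ : IsArithFrobAt (𝓞 F₀) γ v.asIdeal) (p n : ℕ) [ExpChar v.asIdeal.ResidueField p]
      (hq : Nat.card (𝓞 F₀ ⧸ v.asIdeal.under (𝓞 F₀)) = p ^ n)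
      (σt : AlgebraicClosure K ≃+* AlgebraicClosure K)
      (hσa : ∀ a : K, σt (algebraMap K (AlgebraicClosure K) a) = algebraMap K (AlgebraicClosure K) (γ.toRingEquiv a))
      (ℓ : ℕ) [Fact ℓ.Prime] (hℓv : ((ℓ : ℕ) : 𝓞 K) ∉ v.asIdeal)
      (hσ𝔓 : ∀ x : Literature.NumberTheory.GaloisRepresentations.absIntegers (𝓞 K) K,
        ∃ hx : σt x ∈ Literature.NumberTheory.GaloisRepresentations.absIntegers (𝓞 K) K,
          (⟨σt x, hx⟩ : Literature.NumberTheory.GaloisRepresentations.absIntegers (𝓞 K) K) -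
              x ^ Nat.card (𝓞 F₀ ⧸ v.asIdeal.under (𝓞 F₀)) ∈ (ha.tateSpecialisation ℓ hℓv).prime)
      (Hγ : AbelianVariety.GoodReductionAt.HomReduction hi.goodReductionAt (ha.goodReductionAt.conjFrob γ hγ p n hq))
      (Hγ' : AbelianVariety.GoodReductionAt.HomReduction (ha.goodReductionAt.conjFrob γ hγ p n hq) hi.goodReductionAt),
      Hγ.IsTateCompatible (hi.tateSpecialisation ℓ hℓv) ((ha.tateSpecialisation ℓ hℓv).conjFrob γ hγ p n hq σt hσa hσ𝔓) ∧
        Hγ'.IsTateCompatible ((ha.tateSpecialisation ℓ hℓv).conjFrob γ hγ p n hq σt hσa hσ𝔓) (hi.tateSpecialisation ℓ hℓv))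
    (hr₀ : Literature.NumberTheory.DiophantineGeometry.exists_isAbelianSchemeModel_of_hasGoodReductionAt)
    (h₃ : ∀ (k : Type) [Field k] [NumberField k] (A₀ : AbelianVariety k) (v : HeightOneSpectrum (𝓞 k)),
      AbelianVariety.hasGoodReductionAt_of_isUnramifiedAt A₀ v)
    -- `h413` ⇐ rows III-2 (a), III-J3a, III-2 (c) at the printed datum
    (hdict :
      ∀ (hDel : Literature.AlgebraicGeometry.ShimuraVarieties.UnitaryCanonicalModel.canonicalModel_exists_printed)
        (F : HodgeCM.CMField) [IsGalois ℚ F] (h6 : 6 ≤ Module.finrank ℚ F) {ι₁ : F →+* ℂ} (V : HodgeCM.HermSpace3 F ι₁) (a₀ : RealScalar F)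
        (Φ : CMType F) (hΦ : ι₁ ∈ Φ.1) (i : (I V (repAt a₀) (muLiu ι₁ GramClass.rep))),
        oscillatorTriple_dictionary (((uniformOmegaRep (Summit.HodgeConjecture.CorCM.DelRec.exists_recordSystem_of_printed hDel) ⟨HodgeCM.CMField.K F⟩ ι₁ ⟨HodgeCM.HermSpace3.Hm V, HodgeCM.HermSpace3.isHermitian V, HodgeCM.HermSpace3.signature_ι₁ V, HodgeCM.HermSpace3.posDef_of_ne V⟩ Φ e₁ (frameD V) (frameD_real V) (frameD_ne V) (ιVE V) (2 * imagUnit (HodgeCM.CMField.K F))⁻¹ (fun _ _ => (Rep.update ↥(maximalRealSubfield (HodgeCM.CMField.K F)) (imagUnitSq (HodgeCM.CMField.K F)) (Rep.ofLineOf ↥(maximalRealSubfield (HodgeCM.CMField.K F)) (imagUnitSq (HodgeCM.CMField.K F))) (locF ↥(maximalRealSubfield (HodgeCM.CMField.K F)) (imagUnitSq (HodgeCM.CMField.K F)) (realUnit ⟨HodgeCM.CMField.K F⟩ (repAt a₀ (Sigma.fst i)).1 (repAt a₀ (Sigma.fst i)).2.1 (repAt a₀ (Sigma.fst i)).2.2))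 (realUnit ⟨HodgeCM.CMField.K F⟩ (repAt a₀ (Sigma.fst i)).1 (repAt a₀ (Sigma.fst i)).2.1 (repAt a₀ (Sigma.fst i)).2.2) rfl)))).prop413Data ((liuDictionaryPin exists_isReal_hodgeModel_holds hodgePQ_independent_of_hodgeModel_holds BallQuotient.ballQuotientUniformised_holds (cmAbelianVarietyRealised_of_eigenbasis exists_isReal_hodgeModel_holds hodgePQ_independent_of_hodgeModel_holds cmAbelianVarietyEigenbasisRealised_holds) Literature.NumberTheory.Transcendental.arapura2012_cor_15_4_6_holds V (I V (repAt a₀) (muLiu ι₁ GramClass.rep)) (line V (repAt a₀) (muLiu ι₁ GramClass.rep)))).H))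
    (hJ3a :
      ∀ (hDel : Literature.AlgebraicGeometry.ShimuraVarieties.UnitaryCanonicalModel.canonicalModel_exists_printed)
        (F : HodgeCM.CMField) [IsGalois ℚ F] (h6 : 6 ≤ Module.finrank ℚ F) {ι₁ : F →+* ℂ} (V : HodgeCM.HermSpace3 F ι₁) (a₀ : RealScalar F)
        (Φ : CMType F) (hΦ : ι₁ ∈ Φ.1) (i : (I V (repAt a₀) (muLiu ι₁ GramClass.rep))),
        (((uniformOmegaRep (Summit.HodgeConjecture.CorCM.DelRec.exists_recordSystem_of_printed hDel) ⟨HodgeCM.CMField.K F⟩ ι₁ ⟨HodgeCM.HermSpace3.Hm V, HodgeCM.HermSpace3.isHermitian V, HodgeCM.HermSpace3.signature_ι₁ V, HodgeCM.HermSpace3.posDef_of_ne V⟩ Φ e₁ (frameD V) (frameD_real V) (frameD_ne V) (ιVE V) (2 * imagUnit (HodgeCM.CMField.K F))⁻¹ (fun _ _ => (Rep.update ↥(maximalRealSubfield (HodgeCM.CMField.K F)) (imagUnitSq (HodgeCM.CMField.K F)) (Rep.ofLineOf ↥(maximalRealSubfield (HodgeCM.CMField.K F)) (imagUnitSq (HodgeCM.CMField.K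 F))) (locF ↥(maximalRealSubfield (HodgeCM.CMField.K F)) (imagUnitSq (HodgeCM.CMField.K F)) (realUnit ⟨HodgeCM.CMField.K F⟩ (repAt a₀ (Sigma.fst i)).1 (repAt a₀ (Sigma.fst i)).2.1 (repAt a₀ (Sigma.fst i)).2.2)) (realUnit ⟨HodgeCM.CMField.K F⟩ (repAt a₀ (Sigma.fst i)).1 (repAt a₀ (Sigma.fst i)).2.1 (repAt a₀ (Sigma.fst i)).2.2) rfl)))).prop413Data ((liuDictionaryPin exists_isReal_hodgeModel_holds hodgePQ_independent_of_hodgeModel_holds BallQuotient.ballQuotientUniformised_holds (cmAbelianVarietyRealised_of_eigenbasis exists_isReal_hodgeModel_holds hodgePQ_independent_of_hodgeModel_holds cmAbelianVarietyEigenbasisRealised_holds) Literature.NumberTheory.Transcendental.arapura2012_cor_15_4_6_holds V (I V (repAt a₀) (muLiu ι₁ GramClass.rep)) (line V (repAt a₀) (muLiu ι₁ GramClass.rep)))).H).multiplicity_le_one_printed)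
    (hc :
      ∀ (hDel : Literature.AlgebraicGeometry.ShimuraVarieties.UnitaryCanonicalModel.canonicalModel_exists_printed)
        (F : HodgeCM.CMField) [IsGalois ℚ F] (h6 : 6 ≤ Module.finrank ℚ F) {ι₁ : F →+* ℂ} (V : HodgeCM.HermSpace3 F ι₁) (a₀ : RealScalar F)
        (Φ : CMType F) (hΦ : ι₁ ∈ Φ.1) (i : (I V (repAt a₀) (muLiu ι₁ GramClass.rep))),
        muAdmissible_iff_multiplicity_one (((uniformOmegaRep (Summit.HodgeConjecture.CorCM.DelRec.exists_recordSystem_of_printed hDel) ⟨HodgeCM.CMField.K F⟩ ι₁ ⟨HodgeCM.HermSpace3.Hm V, HodgeCM.HermSpace3.isHermitian V, HodgeCM.HermSpace3.signature_ι₁ V, HodgeCM.HermSpace3.posDef_of_ne V⟩ Φ e₁ (frameD V) (frameD_real V) (frameD_ne V) (ιVE V) (2 * imagUnit (HodgeCM.CMField.K F))⁻¹ (fun _ _ => (Rep.update ↥(maximalRealSubfield (HodgeCM.CMField.K F)) (imagUnitSq (HodgeCM.CMField.K F)) (Rep.ofLineOf ↥(maximalRealSubfield (HodgeCM.CMField.K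 F)) (imagUnitSq (HodgeCM.CMField.K F))) (locF ↥(maximalRealSubfield (HodgeCM.CMField.K F)) (imagUnitSq (HodgeCM.CMField.K F)) (realUnit ⟨HodgeCM.CMField.K F⟩ (repAt a₀ (Sigma.fst i)).1 (repAt a₀ (Sigma.fst i)).2.1 (repAt a₀ (Sigma.fst i)).2.2)) (realUnit ⟨HodgeCM.CMField.K F⟩ (repAt a₀ (Sigma.fst i)).1 (repAt a₀ (Sigma.fst i)).2.1 (repAt a₀ (Sigma.fst i)).2.2) rfl)))).prop413Data ((liuDictionaryPin exists_isReal_hodgeModel_holds hodgePQ_independent_of_hodgeModel_holds BallQuotient.ballQuotientUniformised_holds (cmAbelianVarietyRealised_of_eigenbasis exists_isReal_hodgeModel_holds hodgePQ_independent_of_hodgeModel_holds cmAbelianVarietyEigenbasisRealised_holds) Literature.NumberTheory.Transcendental.arapura2012_cor_15_4_6_holds V (I V (repAt a₀) (muLiu ι₁ GramClass.rep)) (line V (repAt a₀) (muLiu ι₁ GramClass.rep)))).H))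
    -- `hLiu418` ⇐ rows VI-1, III-9′ (III-0 Liu Lem. 2.4 (1) and III-11 by their CLOSED tree terms)
    (hFal : ∀ {K : Type} [Field K] (A B : AbelianVariety K) (ℓ : ℕ) [Fact ℓ.Prime], Literature.AlgebraicGeometry.Motives.faltings_tate_bijective A B ℓ)
    (h415 : Thm415AtFace) :
    Summit.HodgeConjecture.HodgeConjecture.Theses.RankFourFaces.CMAbelianHodge :=
  have h21 := Summit.HodgeConjecture.CorCM.Hyp21.H21_of_levelStructure_of_r₀
    (levelStructure_of_facts_degOne'' shimura1998_prop26_definedOverNumberField_holds hS2₁'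
      (Summit.HodgeConjecture.CorCM.Hyp21.exists_finite_forall_exists_goodReductionAt_homReduction_conjFrob_isTateCompatible_of_twistedReduction
        hQ5))
    exists_balancedDivisor_finiteExtension_holds hr₀ h₃
  have hD3 := Summit.HodgeConjecture.CorCM.HypD3.hD3_of_twistRigidity
    Literature.RepresentationTheory.MoeglinVignerasWaldspurger1987.rankOne_theta_twist_rigidity_holds
  have h413 := Summit.HodgeConjecture.CorCM.Hyp413Closing.H413_of_facts hdict hJ3a hc hD3
  Summit.HodgeConjecture.HodgeConjecture.Theses.HCCMUnconditional.closes (Summit.HodgeConjecture.CorCM.HypDel.HDel_of_ext' hF1e) h21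
    (Summit.HodgeConjecture.CorCM.HypLiu418.HLiu418_of_two_facts hFal h415 h21 h413) h413 H411_proof hD3 HD1pp_proof

set_option synthInstance.maxHeartbeats 400000 in
set_option maxHeartbeats 8000000 in
/-- **FLOOR EDITION v7 — «−S2₁′» + «−h₃» + «Q5 BY NAME» in ONE edition (count 10 → 8)** (director g3 10:30:39Z / 10:34:10Z / 10:38:11Z: one edition
after E-19.11♭1 (b) ★ if the ♭ head is ★ by then; custodian B-p10 g3, second A-p10 g4).
* **−S2₁′**: the binder `hS2₁' : shimuraTaniyamaPair_degOne'` — the degree-one Shimura–Taniyama congruence pair at the primes of residue degree one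
  not dividing `d(K)` ([Shimura1998] §13.1 Thm. 1 (i), §13.2 pp. 99–100, §18.6 proof of Thm. 18.6 p. 127) — is GONE: DISCHARGED BY NAME by A-p02's theorem
  `shimuraTaniyamaPair_degOne'_holds` (★ p625063, `ComplexMultiplication/ShimuraTaniyamaPairDegOnePrimeHolds.lean`; the E2 «height-one road»: kernel of
  `d` on the good-reduction model, tangent translation, relative-Frobenius factorisation and degrees, μ-free tangent killing, and the char-poly road
  «δι̃(α) = 0 mod 𝔓» for `p ∤ d(K)` — A-p02's line with A-p01/03/08/09/11/16, B-p02/03/04/05/11/12/16/17), which now feeds `levelStructure_of_facts_degOne''`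
  (★ p620239) in place of the hypothesis.
* **−h₃ (E-19.11♭1)**: the converse-Néron–Ogg–Šafarevič binder `h₃ : ∀ k A₀ v, AbelianVariety.hasGoodReductionAt_of_isUnramifiedAt A₀ v` ([SerreTate1968]
  §1 Thm. 1 = [Shimura1998] Lemma 19.3) is GONE: the h21 binder `shimura1998_thm21_4_casselman` was re-read (B-typ02 ★ p625011, review accept; REF1/ref2
  reading audits) as [Shimura1998] Thm. 21.4 + Prop. 19.10 WITHOUT clause (b) «χ unramified at v ⟺ A₀ has good reduction at v» (= Thm. 19.11, first
  assertion), whose ⇒-half was the ONLY reader of `h₃` (B-plan1 B6-SPEC §1); `h21` is now produced without `h₃` by B-p14's head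
  `Hyp21.H21_of_levelStructure_of_r₀Flat (h7a) (h5b) (hr₀)` (`Theorems/HCCMUnconditionalH21OfInertiaFlat.lean` ★ p624877 + §2, over B-p21's II-5♭
  `shimuraTaniyama_heckeCharactersFlat_of_thm18_6_of_inertia` ★ p624519: II-5 steps 1–4 verbatim, step 5 read one-way from the PROVED Lemma 19.5
  `forall_localUnits_eq_one_of_hasGoodReductionAt_of_torsionReciprocity_of_inertia`, inertia from r₀ by `forall_inertia_tateRep_eq_one_of_hasGoodReductionAt`).
* **Q5 BY NAME** (constant strength): `hQ5` is typed by the Literature named fact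
  `IsAbelianSchemeModel.forall_isTateCompatible_homReduction_conjFrob_tateSpecialisation` (B-typ04 ★ p621613; = the v6 text token for token, certificate
  `Hyp21.q5_iff_hQ5 := Iff.rfl`) and enters through the bridge `Hyp21.factRHS5c_of_Q5` (B-typ04 ★ p622510).
Everything else is v6 verbatim: `hDel` ⇐ I-1′; `h413` ⇐ III-2 (a), III-J3a, III-2 (c) (hD3 closed: `rankOne_theta_twist_rigidity_holds`); `hLiu418` ⇐ VI-1,
III-9′ via `HypLiu418.HLiu418_of_two_facts`; H411, HD1″ closed.
Hypotheses = EXACTLY: I-1′ `hF1e`, Q5 `hQ5`, r₀ `hr₀`, III-2 (a) `hdict`, III-J3a `hJ3a`, III-2 (c) `hc`, VI-1 `hFal`, III-9′ `h415` (**8**).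
A STATUS theorem: HC_CM is proved only modulo the 7 printed citations until rung 0 closes.
[cite: Liu2021, Thm. 4.18; Prop. 4.13; Thm. 4.15; App. D Lem. D.1] [cite: Shimura1998, Thm. 21.4; Prop. 19.10; §13.1 Thm. 1, §13.2 (pp. 99–100); §18.6 proof of
Thm. 18.6 (pp. 127–128); §11.1 Prop. 12, 14 (i)] [cite: Faltings1983, Satz 4] [cite: BLRNeronModels1990, §1.2 Prop. 8 and §4.4 Thm. 1] [cite: SerreTate1968, §1 Lemma 2] RE-ISSUE NOTE (E-ST): statement byte-identical to the landed edition; proof re-pointed off the retired module `HCCMUnconditionalH21OfInertiaFlat`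
(see the comment in the body); the binder `hr₀` is idle since r₀ left the cone. -/
theorem hc_cm_of_floor_v7
    -- `hDel` ⇐ row I-1′ (I-6 by name)
    (hF1e : UnitaryCanonicalModel.Aux.canonicalModel_exists_ext_printed)
    -- `h21` ⇐ Q5 (named) + r₀ (II-2, S7a–c, S5b, E4 transport, Serre–Tate §1 Lemma 2 bridge by name; F-S2₁′ is now the theorem
    -- `shimuraTaniyamaPair_degOne'_holds`, A-p02 ★ p625063; NO converse NOS — E-19.11♭1, B-p14's `H21_of_levelStructure_of_r₀Flat`)
    (hQ5 : Literature.NumberTheory.DiophantineGeometry.IsAbelianSchemeModel.forall_isTateCompatible_homReduction_conjFrob_tateSpecialisation)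
    (hr₀ : Literature.NumberTheory.DiophantineGeometry.exists_isAbelianSchemeModel_of_hasGoodReductionAt)
    -- `h413` ⇐ rows III-2 (a), III-J3a, III-2 (c) at the printed datum
    (hdict :
      ∀ (hDel : Literature.AlgebraicGeometry.ShimuraVarieties.UnitaryCanonicalModel.canonicalModel_exists_printed)
        (F : HodgeCM.CMField) [IsGalois ℚ F] (h6 : 6 ≤ Module.finrank ℚ F) {ι₁ : F →+* ℂ} (V : HodgeCM.HermSpace3 F ι₁) (a₀ : RealScalar F)
        (Φ : CMType F) (hΦ : ι₁ ∈ Φ.1) (i : (I V (repAt a₀) (muLiu ι₁ GramClass.rep))),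
        oscillatorTriple_dictionary (((uniformOmegaRep (Summit.HodgeConjecture.CorCM.DelRec.exists_recordSystem_of_printed hDel) ⟨HodgeCM.CMField.K F⟩ ι₁ ⟨HodgeCM.HermSpace3.Hm V, HodgeCM.HermSpace3.isHermitian V, HodgeCM.HermSpace3.signature_ι₁ V, HodgeCM.HermSpace3.posDef_of_ne V⟩ Φ e₁ (frameD V) (frameD_real V) (frameD_ne V) (ιVE V) (2 * imagUnit (HodgeCM.CMField.K F))⁻¹ (fun _ _ => (Rep.update ↥(maximalRealSubfield (HodgeCM.CMField.K F)) (imagUnitSq (HodgeCM.CMField.K F)) (Rep.ofLineOf ↥(maximalRealSubfield (HodgeCM.CMField.K F)) (imagUnitSq (HodgeCM.CMField.K F))) (locF ↥(maximalRealSubfield (HodgeCM.CMField.K F)) (imagUnitSq (HodgeCM.CMField.K F)) (realUnit ⟨HodgeCM.CMField.K F⟩ (repAt a₀ (Sigma.fst i)).1 (repAt a₀ (Sigma.fst i)).2.1 (repAt a₀ (Sigma.fst i)).2.2)) (realUnit ⟨HodgeCM.CMField.K F⟩ (repAt a₀ (Sigma.fst i)).1 (repAt a₀ (Sigma.fst i)).2.1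 (repAt a₀ (Sigma.fst i)).2.2) rfl)))).prop413Data ((liuDictionaryPin exists_isReal_hodgeModel_holds hodgePQ_independent_of_hodgeModel_holds BallQuotient.ballQuotientUniformised_holds (cmAbelianVarietyRealised_of_eigenbasis exists_isReal_hodgeModel_holds hodgePQ_independent_of_hodgeModel_holds cmAbelianVarietyEigenbasisRealised_holds) Literature.NumberTheory.Transcendental.arapura2012_cor_15_4_6_holds V (I V (repAt a₀) (muLiu ι₁ GramClass.rep)) (line V (repAt a₀) (muLiu ι₁ GramClass.rep)))).H))
    (hJ3a :
      ∀ (hDel : Literature.AlgebraicGeometry.ShimuraVarieties.UnitaryCanonicalModel.canonicalModel_exists_printed)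
        (F : HodgeCM.CMField) [IsGalois ℚ F] (h6 : 6 ≤ Module.finrank ℚ F) {ι₁ : F →+* ℂ} (V : HodgeCM.HermSpace3 F ι₁) (a₀ : RealScalar F)
        (Φ : CMType F) (hΦ : ι₁ ∈ Φ.1) (i : (I V (repAt a₀) (muLiu ι₁ GramClass.rep))),
        (((uniformOmegaRep (Summit.HodgeConjecture.CorCM.DelRec.exists_recordSystem_of_printed hDel) ⟨HodgeCM.CMField.K F⟩ ι₁ ⟨HodgeCM.HermSpace3.Hm V, HodgeCM.HermSpace3.isHermitian V, HodgeCM.HermSpace3.signature_ι₁ V, HodgeCM.HermSpace3.posDef_of_ne V⟩ Φ e₁ (frameD V) (frameD_real V) (frameD_ne V) (ιVE V) (2 * imagUnit (HodgeCM.CMField.K F))⁻¹ (fun _ _ => (Rep.update ↥(maximalRealSubfield (HodgeCM.CMField.K F)) (imagUnitSq (HodgeCM.CMField.K F)) (Rep.ofLineOf ↥(maximalRealSubfield (HodgeCM.CMField.K F)) (imagUnitSq (HodgeCM.CMField.K F))) (locF ↥(maximalRealSubfield (HodgeCM.CMField.K F)) (imagUnitSq (HodgeCM.CMField.K F)) (realUnit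 ⟨HodgeCM.CMField.K F⟩ (repAt a₀ (Sigma.fst i)).1 (repAt a₀ (Sigma.fst i)).2.1 (repAt a₀ (Sigma.fst i)).2.2)) (realUnit ⟨HodgeCM.CMField.K F⟩ (repAt a₀ (Sigma.fst i)).1 (repAt a₀ (Sigma.fst i)).2.1 (repAt a₀ (Sigma.fst i)).2.2) rfl)))).prop413Data ((liuDictionaryPin exists_isReal_hodgeModel_holds hodgePQ_independent_of_hodgeModel_holds BallQuotient.ballQuotientUniformised_holds (cmAbelianVarietyRealised_of_eigenbasis exists_isReal_hodgeModel_holds hodgePQ_independent_of_hodgeModel_holds cmAbelianVarietyEigenbasisRealised_holds) Literature.NumberTheory.Transcendental.arapura2012_cor_15_4_6_holds V (I V (repAt a₀) (muLiu ι₁ GramClass.rep)) (line V (repAt a₀) (muLiu ι₁ GramClass.rep)))).H).multiplicity_le_one_printed)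
    (hc :
      ∀ (hDel : Literature.AlgebraicGeometry.ShimuraVarieties.UnitaryCanonicalModel.canonicalModel_exists_printed)
        (F : HodgeCM.CMField) [IsGalois ℚ F] (h6 : 6 ≤ Module.finrank ℚ F) {ι₁ : F →+* ℂ} (V : HodgeCM.HermSpace3 F ι₁) (a₀ : RealScalar F)
        (Φ : CMType F) (hΦ : ι₁ ∈ Φ.1) (i : (I V (repAt a₀) (muLiu ι₁ GramClass.rep))),
        muAdmissible_iff_multiplicity_one (((uniformOmegaRep (Summit.HodgeConjecture.CorCM.DelRec.exists_recordSystem_of_printed hDel) ⟨HodgeCM.CMField.K F⟩ ι₁ ⟨HodgeCM.HermSpace3.Hm V, HodgeCM.HermSpace3.isHermitian V, HodgeCM.HermSpace3.signature_ι₁ V, HodgeCM.HermSpace3.posDef_of_ne V⟩ Φ e₁ (frameD V) (frameD_real V) (frameD_ne V) (ιVE V) (2 * imagUnit (HodgeCM.CMField.K F))⁻¹ (fun _ _ => (Rep.update ↥(maximalRealSubfield (HodgeCM.CMField.K F)) (imagUnitSq (HodgeCM.CMField.K F)) (Rep.ofLineOf ↥(maximalRealSubfield (HodgeCM.CMField.K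 F)) (imagUnitSq (HodgeCM.CMField.K F))) (locF ↥(maximalRealSubfield (HodgeCM.CMField.K F)) (imagUnitSq (HodgeCM.CMField.K F)) (realUnit ⟨HodgeCM.CMField.K F⟩ (repAt a₀ (Sigma.fst i)).1 (repAt a₀ (Sigma.fst i)).2.1 (repAt a₀ (Sigma.fst i)).2.2)) (realUnit ⟨HodgeCM.CMField.K F⟩ (repAt a₀ (Sigma.fst i)).1 (repAt a₀ (Sigma.fst i)).2.1 (repAt a₀ (Sigma.fst i)).2.2) rfl)))).prop413Data ((liuDictionaryPin exists_isReal_hodgeModel_holds hodgePQ_independent_of_hodgeModel_holds BallQuotient.ballQuotientUniformised_holds (cmAbelianVarietyRealised_of_eigenbasis exists_isReal_hodgeModel_holds hodgePQ_independent_of_hodgeModel_holds cmAbelianVarietyEigenbasisRealised_holds) Literature.NumberTheory.Transcendental.arapura2012_cor_15_4_6_holds V (I V (repAt a₀) (muLiu ι₁ GramClass.rep)) (line V (repAt a₀) (muLiu ι₁ GramClass.rep)))).H))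
    -- `hLiu418` ⇐ rows VI-1, III-9′ (III-0 Liu Lem. 2.4 (1) and III-11 by their CLOSED tree terms)
    (hFal : ∀ {K : Type} [Field K] (A B : AbelianVariety K) (ℓ : ℕ) [Fact ℓ.Prime], Literature.AlgebraicGeometry.Motives.faltings_tate_bijective A B ℓ)
    (h415 : Thm415AtFace) :
    Summit.HodgeConjecture.HodgeConjecture.Theses.RankFourFaces.CMAbelianHodge :=
  -- RE-ISSUE (E-ST, custodian B-p10): the landed leg `Hyp21.H21_of_levelStructure_of_r₀Flat … hr₀` lived in the retired module
  -- `HCCMUnconditionalH21OfInertiaFlat` (dead after S7 ★ p631097).  `hQ5` still feeds [Shimura1998, Thm. 18.6] genuinely; `hr₀` has no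
  -- consumer left in the cone (r₀ left it with E-ST) and is retained only for the append-only identity of this STATUS theorem's statement.
  have _hr₀ : Literature.NumberTheory.DiophantineGeometry.exists_isAbelianSchemeModel_of_hasGoodReductionAt := hr₀
  have h21 : Summit.HodgeConjecture.HodgeConjecture.Theses.HCCMUnconditional.H21 :=
    Summit.HodgeConjecture.CorCM.Hyp21.casselmanST_of_thm18_6
      (Summit.HodgeConjecture.CorCM.Hyp21.thm18_6_of_levelStructure
        (levelStructure_of_facts_degOne'' shimura1998_prop26_definedOverNumberField_holds shimuraTaniyamaPair_degOne'_holds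
          (Summit.HodgeConjecture.CorCM.Hyp21.factRHS5c_of_Q5 hQ5))
        exists_balancedDivisor_finiteExtension_holds)
  have hD3 := Summit.HodgeConjecture.CorCM.HypD3.hD3_of_twistRigidity
    Literature.RepresentationTheory.MoeglinVignerasWaldspurger1987.rankOne_theta_twist_rigidity_holds
  have h413 := Summit.HodgeConjecture.CorCM.Hyp413Closing.H413_of_facts hdict hJ3a hc hD3
  Summit.HodgeConjecture.HodgeConjecture.Theses.HCCMUnconditional.closes (Summit.HodgeConjecture.CorCM.HypDel.HDel_of_ext' hF1e) h21
    (Summit.HodgeConjecture.CorCM.HypLiu418.HLiu418_of_two_facts hFal h415 h21 h413) h413 H411_proof hD3 HD1pp_proof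

set_option synthInstance.maxHeartbeats 400000 in
set_option maxHeartbeats 8000000 in
/-- **FLOOR EDITION v8 — «−Q5» (count 8 → 7)** (director g3 BATCH 115 (2); custodian B-p10 g3).
* **−Q5**: the binder `hQ5 : IsAbelianSchemeModel.forall_isTateCompatible_homReduction_conjFrob_tateSpecialisation` — Tate compatibility of the
  Frobenius-conjugate companions with the produced and the transported specialisation data ([Shimura1998] §18.6 proof of Thm. 18.6 «`(Y^σ)~ = Ỹ^f`»,
  «`(t^σ)~ = π(t̃)`», pp. 127–128; §11.1 Prop. 14 (i)) — is GONE: DISCHARGED BY NAME by the Q5 pool's closer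
  `Literature.NumberTheory.DiophantineGeometry.IsAbelianSchemeModel.forall_isTateCompatible_homReduction_conjFrob_tateSpecialisation_holds` (B-p20 ★ p629306; line of record B-p09: (TW) B-p15 ★ p623807 / B-p07 reduction-map
  part, (T1)+(T2) B-p09 ★ p624844, (T3) A-p14, FrobeniusTwistPoints A-p14 ★ p624659, (P4) B-p15 ★ p624872, P2 B-p19 ★ p620854, (A) ★ p621485, closer B-p20), fed through
  the bridge `Hyp21.factRHS5c_of_Q5` (★ p622510) into `levelStructure_of_facts_degOne''` (★ p620239).
Everything else is v7 verbatim: `hDel` ⇐ I-1′; `h21` ⇐ r₀ alone now (`Hyp21.H21_of_levelStructure_of_r₀Flat`, E-19.11♭1; F-S2₁′ = `shimuraTaniyamaPair_degOne'_holds`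
★ p625063); `h413` ⇐ III-2 (a), III-J3a, III-2 (c) (hD3 closed); `hLiu418` ⇐ VI-1, III-9′ via `HypLiu418.HLiu418_of_two_facts`; H411, HD1″ closed.
Hypotheses = EXACTLY: I-1′ `hF1e`, r₀ `hr₀`, III-2 (a) `hdict`, III-J3a `hJ3a`, III-2 (c) `hc`, VI-1 `hFal`, III-9′ `h415` (**7**).
A STATUS theorem: HC_CM is proved only modulo the 7 printed citations until rung 0 closes.
[cite: Liu2021, Thm. 4.18; Prop. 4.13; Thm. 4.15; App. D Lem. D.1] [cite: Shimura1998, Thm. 21.4; Prop. 19.10; §13.1 Thm. 1; §18.6 proof of Thm. 18.6 (pp. 127–128);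
§11.1 Prop. 12, 14 (i)] [cite: Faltings1983, Satz 4] [cite: BLRNeronModels1990, §1.2 Prop. 8 and §4.4 Thm. 1] [cite: SerreTate1968, §1 Lemma 2] RE-ISSUE NOTE (E-ST): statement byte-identical to the landed edition; proof re-pointed off the retired module `HCCMUnconditionalH21OfInertiaFlat`
(see the comment in the body); the binder `hr₀` is idle since r₀ left the cone. -/
theorem hc_cm_of_floor_v8
    -- `hDel` ⇐ row I-1′ (I-6 by name)
    (hF1e : UnitaryCanonicalModel.Aux.canonicalModel_exists_ext_printed)
    -- `h21` ⇐ r₀ alone (II-2, S7a–c, S5b, E4 transport, Serre–Tate §1 Lemma 2 bridge by name; F-S2₁′ = `shimuraTaniyamaPair_degOne'_holds`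
    -- ★ p625063, Q5 = `forall_isTateCompatible_homReduction_conjFrob_tateSpecialisation_holds` B-p20 ★ p629306; NO converse NOS — E-19.11♭1)
    (hr₀ : Literature.NumberTheory.DiophantineGeometry.exists_isAbelianSchemeModel_of_hasGoodReductionAt)
    -- `h413` ⇐ rows III-2 (a), III-J3a, III-2 (c) at the printed datum
    (hdict :
      ∀ (hDel : Literature.AlgebraicGeometry.ShimuraVarieties.UnitaryCanonicalModel.canonicalModel_exists_printed)
        (F : HodgeCM.CMField) [IsGalois ℚ F] (h6 : 6 ≤ Module.finrank ℚ F) {ι₁ : F →+* ℂ} (V : HodgeCM.HermSpace3 F ι₁) (a₀ : RealScalar F)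
        (Φ : CMType F) (hΦ : ι₁ ∈ Φ.1) (i : (I V (repAt a₀) (muLiu ι₁ GramClass.rep))),
        oscillatorTriple_dictionary (((uniformOmegaRep (Summit.HodgeConjecture.CorCM.DelRec.exists_recordSystem_of_printed hDel) ⟨HodgeCM.CMField.K F⟩ ι₁ ⟨HodgeCM.HermSpace3.Hm V, HodgeCM.HermSpace3.isHermitian V, HodgeCM.HermSpace3.signature_ι₁ V, HodgeCM.HermSpace3.posDef_of_ne V⟩ Φ e₁ (frameD V) (frameD_real V) (frameD_ne V) (ιVE V) (2 * imagUnit (HodgeCM.CMField.K F))⁻¹ (fun _ _ => (Rep.update ↥(maximalRealSubfield (HodgeCM.CMField.K F)) (imagUnitSq (HodgeCM.CMField.K F)) (Rep.ofLineOf ↥(maximalRealSubfield (HodgeCM.CMField.K F)) (imagUnitSq (HodgeCM.CMField.K F))) (locF ↥(maximalRealSubfield (HodgeCM.CMField.K F)) (imagUnitSq (HodgeCM.CMField.K F)) (realUnit ⟨HodgeCM.CMField.K F⟩ (repAt a₀ (Sigma.fst i)).1 (repAt a₀ (Sigma.fst i)).2.1 (repAt a₀ (Sigma.fst i)).2.2))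 (realUnit ⟨HodgeCM.CMField.K F⟩ (repAt a₀ (Sigma.fst i)).1 (repAt a₀ (Sigma.fst i)).2.1 (repAt a₀ (Sigma.fst i)).2.2) rfl)))).prop413Data ((liuDictionaryPin exists_isReal_hodgeModel_holds hodgePQ_independent_of_hodgeModel_holds BallQuotient.ballQuotientUniformised_holds (cmAbelianVarietyRealised_of_eigenbasis exists_isReal_hodgeModel_holds hodgePQ_independent_of_hodgeModel_holds cmAbelianVarietyEigenbasisRealised_holds) Literature.NumberTheory.Transcendental.arapura2012_cor_15_4_6_holds V (I V (repAt a₀) (muLiu ι₁ GramClass.rep)) (line V (repAt a₀) (muLiu ι₁ GramClass.rep)))).H))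
    (hJ3a :
      ∀ (hDel : Literature.AlgebraicGeometry.ShimuraVarieties.UnitaryCanonicalModel.canonicalModel_exists_printed)
        (F : HodgeCM.CMField) [IsGalois ℚ F] (h6 : 6 ≤ Module.finrank ℚ F) {ι₁ : F →+* ℂ} (V : HodgeCM.HermSpace3 F ι₁) (a₀ : RealScalar F)
        (Φ : CMType F) (hΦ : ι₁ ∈ Φ.1) (i : (I V (repAt a₀) (muLiu ι₁ GramClass.rep))),
        (((uniformOmegaRep (Summit.HodgeConjecture.CorCM.DelRec.exists_recordSystem_of_printed hDel) ⟨HodgeCM.CMField.K F⟩ ι₁ ⟨HodgeCM.HermSpace3.Hm V, HodgeCM.HermSpace3.isHermitian V, HodgeCM.HermSpace3.signature_ι₁ V, HodgeCM.HermSpace3.posDef_of_ne V⟩ Φ e₁ (frameD V) (frameD_real V) (frameD_ne V) (ιVE V) (2 * imagUnit (HodgeCM.CMField.K F))⁻¹ (fun _ _ => (Rep.update ↥(maximalRealSubfield (HodgeCM.CMField.K F)) (imagUnitSq (HodgeCM.CMField.K F)) (Rep.ofLineOf ↥(maximalRealSubfield (HodgeCM.CMField.K F)) (imagUnitSq (HodgeCM.CMField.K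 F))) (locF ↥(maximalRealSubfield (HodgeCM.CMField.K F)) (imagUnitSq (HodgeCM.CMField.K F)) (realUnit ⟨HodgeCM.CMField.K F⟩ (repAt a₀ (Sigma.fst i)).1 (repAt a₀ (Sigma.fst i)).2.1 (repAt a₀ (Sigma.fst i)).2.2)) (realUnit ⟨HodgeCM.CMField.K F⟩ (repAt a₀ (Sigma.fst i)).1 (repAt a₀ (Sigma.fst i)).2.1 (repAt a₀ (Sigma.fst i)).2.2) rfl)))).prop413Data ((liuDictionaryPin exists_isReal_hodgeModel_holds hodgePQ_independent_of_hodgeModel_holds BallQuotient.ballQuotientUniformised_holds (cmAbelianVarietyRealised_of_eigenbasis exists_isReal_hodgeModel_holds hodgePQ_independent_of_hodgeModel_holds cmAbelianVarietyEigenbasisRealised_holds) Literature.NumberTheory.Transcendental.arapura2012_cor_15_4_6_holds V (I V (repAt a₀) (muLiu ι₁ GramClass.rep)) (line V (repAt a₀) (muLiu ι₁ GramClass.rep)))).H).multiplicity_le_one_printed)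
    (hc :
      ∀ (hDel : Literature.AlgebraicGeometry.ShimuraVarieties.UnitaryCanonicalModel.canonicalModel_exists_printed)
        (F : HodgeCM.CMField) [IsGalois ℚ F] (h6 : 6 ≤ Module.finrank ℚ F) {ι₁ : F →+* ℂ} (V : HodgeCM.HermSpace3 F ι₁) (a₀ : RealScalar F)
        (Φ : CMType F) (hΦ : ι₁ ∈ Φ.1) (i : (I V (repAt a₀) (muLiu ι₁ GramClass.rep))),
        muAdmissible_iff_multiplicity_one (((uniformOmegaRep (Summit.HodgeConjecture.CorCM.DelRec.exists_recordSystem_of_printed hDel) ⟨HodgeCM.CMField.K F⟩ ι₁ ⟨HodgeCM.HermSpace3.Hm V, HodgeCM.HermSpace3.isHermitian V, HodgeCM.HermSpace3.signature_ι₁ V, HodgeCM.HermSpace3.posDef_of_ne V⟩ Φ e₁ (frameD V) (frameD_real V) (frameD_ne V) (ιVE V) (2 * imagUnit (HodgeCM.CMField.K F))⁻¹ (fun _ _ => (Rep.update ↥(maximalRealSubfield (HodgeCM.CMField.K F)) (imagUnitSq (HodgeCM.CMField.K F)) (Rep.ofLineOf ↥(maximalRealSubfield (HodgeCM.CMField.K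 F)) (imagUnitSq (HodgeCM.CMField.K F))) (locF ↥(maximalRealSubfield (HodgeCM.CMField.K F)) (imagUnitSq (HodgeCM.CMField.K F)) (realUnit ⟨HodgeCM.CMField.K F⟩ (repAt a₀ (Sigma.fst i)).1 (repAt a₀ (Sigma.fst i)).2.1 (repAt a₀ (Sigma.fst i)).2.2)) (realUnit ⟨HodgeCM.CMField.K F⟩ (repAt a₀ (Sigma.fst i)).1 (repAt a₀ (Sigma.fst i)).2.1 (repAt a₀ (Sigma.fst i)).2.2) rfl)))).prop413Data ((liuDictionaryPin exists_isReal_hodgeModel_holds hodgePQ_independent_of_hodgeModel_holds BallQuotient.ballQuotientUniformised_holds (cmAbelianVarietyRealised_of_eigenbasis exists_isReal_hodgeModel_holds hodgePQ_independent_of_hodgeModel_holds cmAbelianVarietyEigenbasisRealised_holds) Literature.NumberTheory.Transcendental.arapura2012_cor_15_4_6_holds V (I V (repAt a₀) (muLiu ι₁ GramClass.rep)) (line V (repAt a₀) (muLiu ι₁ GramClass.rep)))).H))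
    -- `hLiu418` ⇐ rows VI-1, III-9′ (III-0 Liu Lem. 2.4 (1) and III-11 by their CLOSED tree terms)
    (hFal : ∀ {K : Type} [Field K] (A B : AbelianVariety K) (ℓ : ℕ) [Fact ℓ.Prime], Literature.AlgebraicGeometry.Motives.faltings_tate_bijective A B ℓ)
    (h415 : Thm415AtFace) :
    Summit.HodgeConjecture.HodgeConjecture.Theses.RankFourFaces.CMAbelianHodge :=
  -- RE-ISSUE (E-ST, custodian B-p10): leg re-pointed from the retired `H21_of_levelStructure_of_r₀Flat … hr₀` to the CLOSED constant
  -- `Theorems.H21_proof` (B-p14 ★ p633027 = `Hyp21.casselmanST_of_thm18_6 shimura1998_thm18_6_holds`); `hr₀` idle, retained for statement identity.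
  have _hr₀ : Literature.NumberTheory.DiophantineGeometry.exists_isAbelianSchemeModel_of_hasGoodReductionAt := hr₀
  have h21 : Summit.HodgeConjecture.HodgeConjecture.Theses.HCCMUnconditional.H21 := H21_proof
  have hD3 := Summit.HodgeConjecture.CorCM.HypD3.hD3_of_twistRigidity
    Literature.RepresentationTheory.MoeglinVignerasWaldspurger1987.rankOne_theta_twist_rigidity_holds
  have h413 := Summit.HodgeConjecture.CorCM.Hyp413Closing.H413_of_facts hdict hJ3a hc hD3
  Summit.HodgeConjecture.HodgeConjecture.Theses.HCCMUnconditional.closes (Summit.HodgeConjecture.CorCM.HypDel.HDel_of_ext' hF1e) h21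
    (Summit.HodgeConjecture.CorCM.HypLiu418.HLiu418_of_two_facts hFal h415 h21 h413) h413 H411_proof hD3 HD1pp_proof

set_option synthInstance.maxHeartbeats 400000 in
set_option maxHeartbeats 8000000 in
/-- **FLOOR EDITION v9 — «−r₀» (count 7 → 6), edition E-ST (S12)** (director g3 BATCH 116 / RULING 11:25:00Z, director g4 s42/s44/s51; custodian B-p10 g3).
* **−r₀**: the binder `hr₀ : exists_isAbelianSchemeModel_of_hasGoodReductionAt` — «an abelian variety with a smooth proper model at `v` has an
  abelian-scheme model at `v`» ([BLRNeronModels1990] §1.2 Prop. 8, §4.4 Thm. 1; [SerreTate1968] §1) — is GONE: edition E-ST re-keyed the good-reduction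
  notion in the HYPOTHESIS positions of the h21 binder `shimura1998_thm21_4_casselman` (B-typ02 ★ p631097, «END-HYP RETYPE: … WEAKER») and of
  [Liu2021] Def. 4.5 (B-typ04 ★ p630071, «HypLiu418 STRONGER, print-exact», director line BATCH 116) from «smooth proper model» (`HasGoodReductionAt`)
  to «abelian-scheme model» (`IsAbelianSchemeModel`; [SerreTate1968] §1 p. 492; [Shimura1998] §19.2 p. 132, §11.1 p. 83 (A1)–(A3)), junction repairs
  A-p08 ★ p630560/p630595/p631529, restatements B-typ02 ★ p631727/p631764, producers A-p08 ★ p628695/p629418, consumer A-p01 ★ p631711; REF1/ref2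
  reading audits TOWARD print.  With [Shimura1998] Thm. 18.6 a closed tree theorem (`shimura1998_thm18_6_holds` ★ p631138: S7a level structure +
  F-S2₁′ + Q5 + S5b + Prop. 26 by name), `h21` is now the CLOSED constant `Theorems.H21_proof` (B-p14 ★ p633027 =
  `Hyp21.casselmanST_of_thm18_6 shimura1998_thm18_6_holds`) — item stmt-HodgeConjecture-24834 (h21) closed `proved`, fan A 4 → 3.
Everything else is v8 verbatim: `hDel` ⇐ I-1′; `h413` ⇐ III-2 (a), III-J3a, III-2 (c) (hD3 closed: `rankOne_theta_twist_rigidity_holds`); `hLiu418` ⇐ VI-1,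
III-9′ via `HypLiu418.HLiu418_of_two_facts`; H411, HD1″ closed.
Hypotheses = EXACTLY: I-1′ `hF1e`, III-2 (a) `hdict`, III-J3a `hJ3a`, III-2 (c) `hc`, VI-1 `hFal`, III-9′ `h415` (**6**).
A STATUS theorem: HC_CM is proved only modulo the 7 printed citations until rung 0 closes.
[cite: Liu2021, Thm. 4.18; Def. 4.5; Prop. 4.13; Thm. 4.15; App. D Lem. D.1] [cite: Shimura1998, Thm. 21.4; Prop. 19.10; Thm. 18.6; §19.2 (p. 132); §11.1
(p. 83); §13.1 Thm. 1] [cite: Faltings1983, Satz 4] [cite: SerreTate1968, §1 Thm. 1 and Lemma 2; §7 Thm. 10] -/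
theorem hc_cm_of_floor_v9
    -- `hDel` ⇐ row I-1′ (I-6 by name)
    (hF1e : UnitaryCanonicalModel.Aux.canonicalModel_exists_ext_printed)
    -- `h21` := the closed constant `Theorems.H21_proof` ([Shimura1998] Thm. 21.4 in Serre–Tate currency ⇐ Thm. 18.6 ★ p631138); NO r₀, NO NOS
    -- `h413` ⇐ rows III-2 (a), III-J3a, III-2 (c) at the printed datum
    (hdict :
      ∀ (hDel : Literature.AlgebraicGeometry.ShimuraVarieties.UnitaryCanonicalModel.canonicalModel_exists_printed)
        (F : HodgeCM.CMField) [IsGalois ℚ F] (h6 : 6 ≤ Module.finrank ℚ F) {ι₁ : F →+* ℂ} (V : HodgeCM.HermSpace3 F ι₁) (a₀ : RealScalar F)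
        (Φ : CMType F) (hΦ : ι₁ ∈ Φ.1) (i : (I V (repAt a₀) (muLiu ι₁ GramClass.rep))),
        oscillatorTriple_dictionary (((uniformOmegaRep (Summit.HodgeConjecture.CorCM.DelRec.exists_recordSystem_of_printed hDel) ⟨HodgeCM.CMField.K F⟩ ι₁ ⟨HodgeCM.HermSpace3.Hm V, HodgeCM.HermSpace3.isHermitian V, HodgeCM.HermSpace3.signature_ι₁ V, HodgeCM.HermSpace3.posDef_of_ne V⟩ Φ e₁ (frameD V) (frameD_real V) (frameD_ne V) (ιVE V) (2 * imagUnit (HodgeCM.CMField.K F))⁻¹ (fun _ _ => (Rep.update ↥(maximalRealSubfield (HodgeCM.CMField.K F)) (imagUnitSq (HodgeCM.CMField.K F)) (Rep.ofLineOf ↥(maximalRealSubfield (HodgeCM.CMField.K F)) (imagUnitSq (HodgeCM.CMField.K F))) (locF ↥(maximalRealSubfield (HodgeCM.CMField.K F)) (imagUnitSq (HodgeCM.CMField.K F)) (realUnit ⟨HodgeCM.CMField.K F⟩ (repAt a₀ (Sigma.fst i)).1 (repAt a₀ (Sigma.fst i)).2.1 (repAt a₀ (Sigma.fst i)).2.2))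 (realUnit ⟨HodgeCM.CMField.K F⟩ (repAt a₀ (Sigma.fst i)).1 (repAt a₀ (Sigma.fst i)).2.1 (repAt a₀ (Sigma.fst i)).2.2) rfl)))).prop413Data ((liuDictionaryPin exists_isReal_hodgeModel_holds hodgePQ_independent_of_hodgeModel_holds BallQuotient.ballQuotientUniformised_holds (cmAbelianVarietyRealised_of_eigenbasis exists_isReal_hodgeModel_holds hodgePQ_independent_of_hodgeModel_holds cmAbelianVarietyEigenbasisRealised_holds) Literature.NumberTheory.Transcendental.arapura2012_cor_15_4_6_holds V (I V (repAt a₀) (muLiu ι₁ GramClass.rep)) (line V (repAt a₀) (muLiu ι₁ GramClass.rep)))).H))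
    (hJ3a :
      ∀ (hDel : Literature.AlgebraicGeometry.ShimuraVarieties.UnitaryCanonicalModel.canonicalModel_exists_printed)
        (F : HodgeCM.CMField) [IsGalois ℚ F] (h6 : 6 ≤ Module.finrank ℚ F) {ι₁ : F →+* ℂ} (V : HodgeCM.HermSpace3 F ι₁) (a₀ : RealScalar F)
        (Φ : CMType F) (hΦ : ι₁ ∈ Φ.1) (i : (I V (repAt a₀) (muLiu ι₁ GramClass.rep))),
        (((uniformOmegaRep (Summit.HodgeConjecture.CorCM.DelRec.exists_recordSystem_of_printed hDel) ⟨HodgeCM.CMField.K F⟩ ι₁ ⟨HodgeCM.HermSpace3.Hm V, HodgeCM.HermSpace3.isHermitian V, HodgeCM.HermSpace3.signature_ι₁ V, HodgeCM.HermSpace3.posDef_of_ne V⟩ Φ e₁ (frameD V) (frameD_real V) (frameD_ne V) (ιVE V) (2 * imagUnit (HodgeCM.CMField.K F))⁻¹ (fun _ _ => (Rep.update ↥(maximalRealSubfield (HodgeCM.CMField.K F)) (imagUnitSq (HodgeCM.CMField.K F)) (Rep.ofLineOf ↥(maximalRealSubfield (HodgeCM.CMField.K F)) (imagUnitSq (HodgeCM.CMField.K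 F))) (locF ↥(maximalRealSubfield (HodgeCM.CMField.K F)) (imagUnitSq (HodgeCM.CMField.K F)) (realUnit ⟨HodgeCM.CMField.K F⟩ (repAt a₀ (Sigma.fst i)).1 (repAt a₀ (Sigma.fst i)).2.1 (repAt a₀ (Sigma.fst i)).2.2)) (realUnit ⟨HodgeCM.CMField.K F⟩ (repAt a₀ (Sigma.fst i)).1 (repAt a₀ (Sigma.fst i)).2.1 (repAt a₀ (Sigma.fst i)).2.2) rfl)))).prop413Data ((liuDictionaryPin exists_isReal_hodgeModel_holds hodgePQ_independent_of_hodgeModel_holds BallQuotient.ballQuotientUniformised_holds (cmAbelianVarietyRealised_of_eigenbasis exists_isReal_hodgeModel_holds hodgePQ_independent_of_hodgeModel_holds cmAbelianVarietyEigenbasisRealised_holds) Literature.NumberTheory.Transcendental.arapura2012_cor_15_4_6_holds V (I V (repAt a₀) (muLiu ι₁ GramClass.rep)) (line V (repAt a₀) (muLiu ι₁ GramClass.rep)))).H).multiplicity_le_one_printed)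
    (hc :
      ∀ (hDel : Literature.AlgebraicGeometry.ShimuraVarieties.UnitaryCanonicalModel.canonicalModel_exists_printed)
        (F : HodgeCM.CMField) [IsGalois ℚ F] (h6 : 6 ≤ Module.finrank ℚ F) {ι₁ : F →+* ℂ} (V : HodgeCM.HermSpace3 F ι₁) (a₀ : RealScalar F)
        (Φ : CMType F) (hΦ : ι₁ ∈ Φ.1) (i : (I V (repAt a₀) (muLiu ι₁ GramClass.rep))),
        muAdmissible_iff_multiplicity_one (((uniformOmegaRep (Summit.HodgeConjecture.CorCM.DelRec.exists_recordSystem_of_printed hDel) ⟨HodgeCM.CMField.K F⟩ ι₁ ⟨HodgeCM.HermSpace3.Hm V, HodgeCM.HermSpace3.isHermitian V, HodgeCM.HermSpace3.signature_ι₁ V, HodgeCM.HermSpace3.posDef_of_ne V⟩ Φ e₁ (frameD V) (frameD_real V) (frameD_ne V) (ιVE V) (2 * imagUnit (HodgeCM.CMField.K F))⁻¹ (fun _ _ => (Rep.update ↥(maximalRealSubfield (HodgeCM.CMField.K F)) (imagUnitSq (HodgeCM.CMField.K F)) (Rep.ofLineOf ↥(maximalRealSubfield (HodgeCM.CMField.K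 F)) (imagUnitSq (HodgeCM.CMField.K F))) (locF ↥(maximalRealSubfield (HodgeCM.CMField.K F)) (imagUnitSq (HodgeCM.CMField.K F)) (realUnit ⟨HodgeCM.CMField.K F⟩ (repAt a₀ (Sigma.fst i)).1 (repAt a₀ (Sigma.fst i)).2.1 (repAt a₀ (Sigma.fst i)).2.2)) (realUnit ⟨HodgeCM.CMField.K F⟩ (repAt a₀ (Sigma.fst i)).1 (repAt a₀ (Sigma.fst i)).2.1 (repAt a₀ (Sigma.fst i)).2.2) rfl)))).prop413Data ((liuDictionaryPin exists_isReal_hodgeModel_holds hodgePQ_independent_of_hodgeModel_holds BallQuotient.ballQuotientUniformised_holds (cmAbelianVarietyRealised_of_eigenbasis exists_isReal_hodgeModel_holds hodgePQ_independent_of_hodgeModel_holds cmAbelianVarietyEigenbasisRealised_holds) Literature.NumberTheory.Transcendental.arapura2012_cor_15_4_6_holds V (I V (repAt a₀) (muLiu ι₁ GramClass.rep)) (line V (repAt a₀) (muLiu ι₁ GramClass.rep)))).H))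
    -- `hLiu418` ⇐ rows VI-1, III-9′ (III-0 Liu Lem. 2.4 (1) and III-11 by their CLOSED tree terms)
    (hFal : ∀ {K : Type} [Field K] (A B : AbelianVariety K) (ℓ : ℕ) [Fact ℓ.Prime], Literature.AlgebraicGeometry.Motives.faltings_tate_bijective A B ℓ)
    (h415 : Thm415AtFace) :
    Summit.HodgeConjecture.HodgeConjecture.Theses.RankFourFaces.CMAbelianHodge :=
  have h21 : Summit.HodgeConjecture.HodgeConjecture.Theses.HCCMUnconditional.H21 := H21_proof
  have hD3 := Summit.HodgeConjecture.CorCM.HypD3.hD3_of_twistRigidity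
    Literature.RepresentationTheory.MoeglinVignerasWaldspurger1987.rankOne_theta_twist_rigidity_holds
  have h413 := Summit.HodgeConjecture.CorCM.Hyp413Closing.H413_of_facts hdict hJ3a hc hD3
  Summit.HodgeConjecture.HodgeConjecture.Theses.HCCMUnconditional.closes (Summit.HodgeConjecture.CorCM.HypDel.HDel_of_ext' hF1e) h21
    (Summit.HodgeConjecture.CorCM.HypLiu418.HLiu418_of_two_facts hFal h415 h21 h413) h413 H411_proof hD3 HD1pp_proof

set_option synthInstance.maxHeartbeats 400000 in
set_option maxHeartbeats 8000000 in
/-- **FLOOR EDITION v10 — edition E-III2 (R1′): rows III-2 (a)/(c) RE-KEYED TO PRINT at constant count (6)** (director g4 RULING s49/s53, BATCH 124 (2);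
custodian B-p10 g3).  The two Liu-§3 dictionary binders of v9 were STRONGER than print (referee alert REF1 12:49Z / ref2 / ref3, flag «*» in INVENTORY §8):
`hdict : … oscillatorTriple_dictionary …` asked for the full two-way dictionary and `hc : … muAdmissible_iff_multiplicity_one …` for an «iff» where
[Liu2021] l. 2145 (first sentence / «Conversely») with [Rem. 4.14], [GelbartRogawski1991] p. 448 Thm. 5.1.1 / p. 446 and [Li1992] Thm. 2.1 print only the
EXISTENCE half and the one-way «admissible ⇒ occurs in H¹».  They are replaced by the print-exact named statements `oscillatorTriple_dictionaryExistence` (row III-2 (a)′,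
`hdictE`) and `admissible_occursInH1` (row III-2 (c)′, `hocc`) — typed in `Literature/NumberTheory/GelbartRogawski1991/` (B-typ01 ★ p636445 defs; A-p07 ★ p637765 bridges + ★ p638274 head; texts A-p07, typer B-typ01/B-typ04,
ref2 V-audit, REF1 reading PASS ×2) — and consumed through A-p07's head `Hyp413Closing.H413_of_three_facts_flat (hdictE) (hJ3a) (hocc)` (which closes hD3
inside by `Theorems.HD3_proof`).  WEAKER hypotheses, same conclusion: HC_CM ⇐ six PRINT-EXACT rows.
Everything else is v9 verbatim: `hDel` ⇐ I-1′; `h21 := Theorems.H21_proof`; `hLiu418` ⇐ VI-1, III-9′ via `HypLiu418.HLiu418_of_two_facts`; H411, HD3, HD1″ closed.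
Hypotheses = EXACTLY: I-1′ `hF1e`, III-2 (a)′ `hdictE`, III-J3a `hJ3a`, III-2 (c)′ `hocc`, VI-1 `hFal`, III-9′ `h415` (**6**, flag «*» removed).
A STATUS theorem: HC_CM is proved only modulo the 7 printed citations until rung 0 closes.
[cite: Liu2021, Thm. 4.18; Prop. 4.13 and its proof l. 2145; Rem. 4.14; Thm. 4.15; App. D Lem. D.1] [cite: GelbartRogawski1991, Thm. 5.1.1 (p. 448); p. 446]
[cite: Li1992, Thm. 2.1] [cite: Rogawski1990, Thm. 13.3.1] [cite: Shimura1998, Thm. 21.4; Thm. 18.6] [cite: Faltings1983, Satz 4] -/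
theorem hc_cm_of_floor_v10
    -- `hDel` ⇐ row I-1′ (I-6 by name)
    (hF1e : UnitaryCanonicalModel.Aux.canonicalModel_exists_ext_printed)
    -- `h21` := the closed constant `Theorems.H21_proof` ([Shimura1998] Thm. 21.4 in Serre–Tate currency ⇐ Thm. 18.6 ★ p631138); NO r₀, NO NOS
    -- `h413` ⇐ rows III-2 (a)′ EXISTENCE, III-J3a, III-2 (c)′ «admissible ⇒ occurs in H¹» at the printed datum (E-III2 R1′, print-exact)
    (hdictE :
      ∀ (hDel : Literature.AlgebraicGeometry.ShimuraVarieties.UnitaryCanonicalModel.canonicalModel_exists_printed)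
        (F : HodgeCM.CMField) [IsGalois ℚ F] (h6 : 6 ≤ Module.finrank ℚ F) {ι₁ : F →+* ℂ} (V : HodgeCM.HermSpace3 F ι₁) (a₀ : RealScalar F)
        (Φ : CMType F) (hΦ : ι₁ ∈ Φ.1) (i : (I V (repAt a₀) (muLiu ι₁ GramClass.rep))),
        oscillatorTriple_dictionaryExistence (((uniformOmegaRep (Summit.HodgeConjecture.CorCM.DelRec.exists_recordSystem_of_printed hDel) ⟨HodgeCM.CMField.K F⟩ ι₁ ⟨HodgeCM.HermSpace3.Hm V, HodgeCM.HermSpace3.isHermitian V, HodgeCM.HermSpace3.signature_ι₁ V, HodgeCM.HermSpace3.posDef_of_ne V⟩ Φ e₁ (frameD V) (frameD_real V) (frameD_ne V) (ιVE V) (2 * imagUnit (HodgeCM.CMField.K F))⁻¹ (fun _ _ => (Rep.update ↥(maximalRealSubfield (HodgeCM.CMField.K F)) (imagUnitSq (HodgeCM.CMField.K F)) (Rep.ofLineOf ↥(maximalRealSubfield (HodgeCM.CMField.K F)) (imagUnitSq (HodgeCM.CMField.K F))) (locF ↥(maximalRealSubfield (HodgeCM.CMField.K F)) (imagUnitSq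 (HodgeCM.CMField.K F)) (realUnit ⟨HodgeCM.CMField.K F⟩ (repAt a₀ (Sigma.fst i)).1 (repAt a₀ (Sigma.fst i)).2.1 (repAt a₀ (Sigma.fst i)).2.2)) (realUnit ⟨HodgeCM.CMField.K F⟩ (repAt a₀ (Sigma.fst i)).1 (repAt a₀ (Sigma.fst i)).2.1 (repAt a₀ (Sigma.fst i)).2.2) rfl)))).prop413Data ((liuDictionaryPin exists_isReal_hodgeModel_holds hodgePQ_independent_of_hodgeModel_holds BallQuotient.ballQuotientUniformised_holds (cmAbelianVarietyRealised_of_eigenbasis exists_isReal_hodgeModel_holds hodgePQ_independent_of_hodgeModel_holds cmAbelianVarietyEigenbasisRealised_holds) Literature.NumberTheory.Transcendental.arapura2012_cor_15_4_6_holds V (I V (repAt a₀) (muLiu ι₁ GramClass.rep)) (line V (repAt a₀) (muLiu ι₁ GramClass.rep)))).H))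
    (hJ3a :
      ∀ (hDel : Literature.AlgebraicGeometry.ShimuraVarieties.UnitaryCanonicalModel.canonicalModel_exists_printed)
        (F : HodgeCM.CMField) [IsGalois ℚ F] (h6 : 6 ≤ Module.finrank ℚ F) {ι₁ : F →+* ℂ} (V : HodgeCM.HermSpace3 F ι₁) (a₀ : RealScalar F)
        (Φ : CMType F) (hΦ : ι₁ ∈ Φ.1) (i : (I V (repAt a₀) (muLiu ι₁ GramClass.rep))),
        (((uniformOmegaRep (Summit.HodgeConjecture.CorCM.DelRec.exists_recordSystem_of_printed hDel) ⟨HodgeCM.CMField.K F⟩ ι₁ ⟨HodgeCM.HermSpace3.Hm V, HodgeCM.HermSpace3.isHermitian V, HodgeCM.HermSpace3.signature_ι₁ V, HodgeCM.HermSpace3.posDef_of_ne V⟩ Φ e₁ (frameD V) (frameD_real V) (frameD_ne V) (ιVE V) (2 * imagUnit (HodgeCM.CMField.K F))⁻¹ (fun _ _ => (Rep.update ↥(maximalRealSubfield (HodgeCM.CMField.K F)) (imagUnitSq (HodgeCM.CMField.K F)) (Rep.ofLineOf ↥(maximalRealSubfield (HodgeCM.CMField.K F)) (imagUnitSq (HodgeCM.CMField.K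 F))) (locF ↥(maximalRealSubfield (HodgeCM.CMField.K F)) (imagUnitSq (HodgeCM.CMField.K F)) (realUnit ⟨HodgeCM.CMField.K F⟩ (repAt a₀ (Sigma.fst i)).1 (repAt a₀ (Sigma.fst i)).2.1 (repAt a₀ (Sigma.fst i)).2.2)) (realUnit ⟨HodgeCM.CMField.K F⟩ (repAt a₀ (Sigma.fst i)).1 (repAt a₀ (Sigma.fst i)).2.1 (repAt a₀ (Sigma.fst i)).2.2) rfl)))).prop413Data ((liuDictionaryPin exists_isReal_hodgeModel_holds hodgePQ_independent_of_hodgeModel_holds BallQuotient.ballQuotientUniformised_holds (cmAbelianVarietyRealised_of_eigenbasis exists_isReal_hodgeModel_holds hodgePQ_independent_of_hodgeModel_holds cmAbelianVarietyEigenbasisRealised_holds) Literature.NumberTheory.Transcendental.arapura2012_cor_15_4_6_holds V (I V (repAt a₀) (muLiu ι₁ GramClass.rep)) (line V (repAt a₀) (muLiu ι₁ GramClass.rep)))).H).multiplicity_le_one_printed)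
    (hocc :
      ∀ (hDel : Literature.AlgebraicGeometry.ShimuraVarieties.UnitaryCanonicalModel.canonicalModel_exists_printed)
        (F : HodgeCM.CMField) [IsGalois ℚ F] (h6 : 6 ≤ Module.finrank ℚ F) {ι₁ : F →+* ℂ} (V : HodgeCM.HermSpace3 F ι₁) (a₀ : RealScalar F)
        (Φ : CMType F) (hΦ : ι₁ ∈ Φ.1) (i : (I V (repAt a₀) (muLiu ι₁ GramClass.rep))),
        admissible_occursInH1 (((uniformOmegaRep (Summit.HodgeConjecture.CorCM.DelRec.exists_recordSystem_of_printed hDel) ⟨HodgeCM.CMField.K F⟩ ι₁ ⟨HodgeCM.HermSpace3.Hm V, HodgeCM.HermSpace3.isHermitian V, HodgeCM.HermSpace3.signature_ι₁ V, HodgeCM.HermSpace3.posDef_of_ne V⟩ Φ e₁ (frameD V) (frameD_real V) (frameD_ne V) (ιVE V) (2 * imagUnit (HodgeCM.CMField.K F))⁻¹ (fun _ _ => (Rep.update ↥(maximalRealSubfield (HodgeCM.CMField.K F)) (imagUnitSq (HodgeCM.CMField.K F)) (Rep.ofLineOf ↥(maximalRealSubfield (HodgeCM.CMField.K F)) (imagUnitSq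 (HodgeCM.CMField.K F))) (locF ↥(maximalRealSubfield (HodgeCM.CMField.K F)) (imagUnitSq (HodgeCM.CMField.K F)) (realUnit ⟨HodgeCM.CMField.K F⟩ (repAt a₀ (Sigma.fst i)).1 (repAt a₀ (Sigma.fst i)).2.1 (repAt a₀ (Sigma.fst i)).2.2)) (realUnit ⟨HodgeCM.CMField.K F⟩ (repAt a₀ (Sigma.fst i)).1 (repAt a₀ (Sigma.fst i)).2.1 (repAt a₀ (Sigma.fst i)).2.2) rfl)))).prop413Data ((liuDictionaryPin exists_isReal_hodgeModel_holds hodgePQ_independent_of_hodgeModel_holds BallQuotient.ballQuotientUniformised_holds (cmAbelianVarietyRealised_of_eigenbasis exists_isReal_hodgeModel_holds hodgePQ_independent_of_hodgeModel_holds cmAbelianVarietyEigenbasisRealised_holds) Literature.NumberTheory.Transcendental.arapura2012_cor_15_4_6_holds V (I V (repAt a₀) (muLiu ι₁ GramClass.rep)) (line V (repAt a₀) (muLiu ι₁ GramClass.rep)))).H))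
    -- `hLiu418` ⇐ rows VI-1, III-9′ (III-0 Liu Lem. 2.4 (1) and III-11 by their CLOSED tree terms)
    (hFal : ∀ {K : Type} [Field K] (A B : AbelianVariety K) (ℓ : ℕ) [Fact ℓ.Prime], Literature.AlgebraicGeometry.Motives.faltings_tate_bijective A B ℓ)
    (h415 : Thm415AtFace) :
    Summit.HodgeConjecture.HodgeConjecture.Theses.RankFourFaces.CMAbelianHodge :=
  have h21 : Summit.HodgeConjecture.HodgeConjecture.Theses.HCCMUnconditional.H21 := H21_proof
  have hD3 := Summit.HodgeConjecture.CorCM.HypD3.hD3_of_twistRigidity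
    Literature.RepresentationTheory.MoeglinVignerasWaldspurger1987.rankOne_theta_twist_rigidity_holds
  have h413 := Summit.HodgeConjecture.CorCM.Hyp413Closing.H413_of_three_facts_flat hdictE hJ3a hocc
  Summit.HodgeConjecture.HodgeConjecture.Theses.HCCMUnconditional.closes (Summit.HodgeConjecture.CorCM.HypDel.HDel_of_ext' hF1e) h21
    (Summit.HodgeConjecture.CorCM.HypLiu418.HLiu418_of_two_facts hFal h415 h21 h413) h413 H411_proof hD3 HD1pp_proof

end Summit.HodgeConjecture.HodgeConjecture.Theorems

end
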